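import Literature.NumberTheory.QuadraticFields.GaussianQuarticSymbolValues
import HarnessLib

/-!
# The quartic symbol `(x/a)₄` of a Gaussian integer modulo a rational integer, and the inert primes `q ≡ 3 (4)`

Topic `Literature/NumberTheory/QuadraticFields`, namespace `Literature.NumberTheory.QuadraticFields.GaussianQuarticSymbol`
(continuing `GaussianQuarticSymbol.lean` / `GaussianQuarticSymbolValues.lean`).  One definition with body and its API;
no named fact (net Literature debt 0).

`GaussianQuarticSymbol.lean` pulls Ireland–Rosen's `χ_x(D) = (D/x)₄` — the symbol of a RATIONAL INTEGER `D` modulo a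
Gaussian integer `x` — back to Mathlib's `GaussianInt` (`quarticSymbolInt D x`), and records the quartic character
modulo the single inert prime `3` by its table (`quarticCharThree`, `(x/3)₄ ≡ x² (mod 3)`).  This file supplies the
symbol in the OTHER direction for every integer modulus,

* `quarticCharMod a x = (x/a)₄ = χ_a(x)` (`a ∈ ℤ`, `x ∈ ℤ[i]`): the tree's `quarticSymbol (Ideal.span {a}) (Φ₄ x)` on
  `𝓞 ℚ(ζ₄)` read back through the bridge `Φ₄ : GaussianInt ≃+* 𝓞 ℚ(ζ₄)` — Ireland–Rosen Ch. 9 §8, Definition after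
  Prop. 9.8.4 («`χ_α(β) = ∏ χ_{λᵢ}(β)`») with `α = a`; multiplicative in `x` (Prop. 9.8.3 (b)), a function of
  `x mod a` («if `β ≡ γ (α)` then `χ_α(β) = χ_α(γ)`»), `χ_{-a} = χ_a`;
* Prop. 9.9.8 in this currency: for `a ≡ 1 (4)` and primary `x` coprime to `a`, `(a/x)₄ = (x/a)₄`
  (`quarticSymbolInt_eq_quarticCharMod_of_isPrimary`, a restatement of the tree's `map_quarticSymbolInt_of_isPrimary`);

and, at a rational prime `q ≡ 3 (4)` (inert in `ℤ[i]`, `N(q) = q²`, Ch. 9 §7 Lemma 4 / §8 Prop. 9.8.4), the quartic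
residue character `χ_q` of the field `ℤ[i]/q = 𝔽_{q²}`:

* `quarticCharMod_eq_zero_iff` (`χ_q(x) = 0 ↔ q ∣ x`), Euler's criterion `q ∣ x^{(q²-1)/4} − χ_q(x)`, `χ_q(x)⁴ = 1`
  (`quarticCharMod_spec`, Prop. 9.8.2 and the Definition), the characterisation `quarticCharMod_eq_of_pow_four_eq_one`,
  `χ_q(n) = 1` for `n ∈ ℤ`, `q ∤ n` (Prop. 9.8.4), `χ_q(u) = u^{(q²-1)/4}` on units;
* **`quarticSymbolInt_neg_natCast_of_isPrimary`: `(-q/x)₄ = (x/q)₄ = χ_q(x)` for primary `x`** (Prop. 9.9.8 with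
  `a = -q ≡ 1 (4)`; both sides vanish when `q ∣ x`), and the `q`-part split of a twist
  `((-q)^k D₁/x)₄ = χ_q(x)^k (D₁/x)₄` (`quarticSymbolInt_neg_natCast_pow_mul_of_isPrimary`) — the generalisation to every
  inert prime of `quarticSymbolInt_neg_three_of_isPrimary` / `…_neg_three_pow_mul_of_isPrimary`, which is how the prime
  `q` of `D = (-q)^k D₁` separates from the rest of the quartic twist `(D/x)₄` of `y² = x³ − Dx` (Ch. 18 §6);
* `quarticCharMod_three : quarticCharMod 3 x = quarticCharThree x` (the table at `q = 3` is the case `q = 3`).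

## References
* K. Ireland, M. Rosen, *A Classical Introduction to Modern Number Theory* (1982/1990), Ch. 9 §7 Lemma 4, §8 Props. 9.8.2–9.8.4
  and the Definition after Prop. 9.8.4, §9 Prop. 9.9.8; Ch. 18 §6 (Lemma and proof of Theorem 7). [IrelandRosen1982]

## Mathlib / tree search
Tree: `quarticSymbol`, `quarticSymbol_span_neg`, `quarticSymbol_mul_right`, `quarticSymbol_eq_of_sub_mem`,
`quarticSymbol_span_of_span_eq`, `inertPlace`, `inertPlace_asIdeal`, `residueCard_inertPlace`, `two_not_mem_inertPlace`
(`GaloisRepresentations/QuarticResidueSymbolComposite`); `quarticResidueSymbol_spec`, `quarticResidueSymbol_eq_of_pow_four_eq_one`,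
`quarticResidueSymbol_ne_zero_iff`, `quarticResidueSymbol_intCast_eq_one_of_residueCard_eq_sq` (`…/QuarticResidueSymbol`);
`Φ₄`, `K₄`, `isPrimitiveRoot_ζ₄`, `quarticSymbolInt`, `map_quarticSymbolInt_of_isPrimary`, `quarticSymbolInt_mul/_mul_left/_pow_left`,
`quarticCharThree`, `three_dvd_sq_sub_quarticCharThree` (`QuadraticFields/GaussianQuarticSymbol`); `eq_of_pow_four_eq_one`,
`quarticSymbolInt_natCast_of_mod_four_eq_three` (`…/GaussianQuarticSymbolValues`); `IsPrimary` (`…/GaussianPrimary`).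
Mathlib: `GaussianInt.prime_iff_mod_four_eq_three_of_nat_prime`, `Irreducible.coprime_iff_not_dvd`, `Ideal.Quotient.eq`,
`Ideal.mem_span_singleton`, `map_dvd_iff`.  `lean search 'quarticChar'`: only `quarticCharThree` existed.
-/

noncomputable section

namespace Literature.NumberTheory.QuadraticFields.GaussianQuarticSymbol

open NumberField IsDedekindDomain Zsqrtd
open Literature.NumberTheory.NumberFields Literature.NumberTheory.GaloisRepresentations
open Literature.NumberTheory.QuadraticFields.GaussianPrimary

/-! ### §1 `(x/a)₄` for an integer modulus `a` -/

section Mod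

/-- **`(x/a)₄ = χ_a(x) ∈ ℤ[i]`** for `a ∈ ℤ`, `x ∈ ℤ[i]`: the quartic symbol of the Gaussian integer `x` modulo the ideal
`(a)` of `ℤ[i]`, Ireland–Rosen's `χ_a(x) = ∏ᵢ χ_{λᵢ}(x)` over a prime factorisation `a = ∏ λᵢ` (Ch. 9 §8, Definition
after Prop. 9.8.4; Ch. 14 §2), i.e. the tree's `quarticSymbol (Ideal.span {a}) (Φ₄ x)` on `𝓞 ℚ(ζ₄)` pulled back along
`Φ₄ : GaussianInt ≃+* 𝓞 ℚ(ζ₄)`.  Values `0, ±1, ±i`.  Junk values (inherited): `(x/0)₄ = 1`, `(x/±1)₄ = 1` (empty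
factorisation), and `(x/a)₄ = 0` for even `a` (a factor at the prime `1 + i`, where Ireland–Rosen leave `χ` undefined).
[cite: IrelandRosen1982, Ch. 9 §8, Definition after Prop. 9.8.4; Ch. 14 §2, Definition] -/
def quarticCharMod (a : ℤ) (x : GaussianInt) : GaussianInt :=
  Φ₄.symm (quarticSymbol (Ideal.span {(a : 𝓞 K₄)}) (Φ₄ x))

/-- Unfolding: `Φ₄ ((x/a)₄) = (Φ₄ x/(a))₄`. [cite: IrelandRosen1982, Ch. 9 §8, Definition after Prop. 9.8.4] -/
theorem map_quarticCharMod (a : ℤ) (x : GaussianInt) :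
    Φ₄ (quarticCharMod a x) = quarticSymbol (Ideal.span {(a : 𝓞 K₄)}) (Φ₄ x) := by
  rw [quarticCharMod, RingEquiv.apply_symm_apply]

/-- `χ_{-a} = χ_a` (the symbol depends on the ideal `(a)` only). [cite: IrelandRosen1982, Ch. 9 §8, Prop. 9.8.3 (f)] -/
theorem quarticCharMod_neg (a : ℤ) (x : GaussianInt) : quarticCharMod (-a) x = quarticCharMod a x := by
  apply Φ₄.injective
  rw [map_quarticCharMod, map_quarticCharMod, Int.cast_neg, quarticSymbol_span_neg]

/-- **Prop. 9.8.3 (b) for the modulus `a`: `(xy/a)₄ = (x/a)₄ (y/a)₄`.** [cite: IrelandRosen1982, Ch. 9 §8, Prop. 9.8.3 (b); Ch. 14 §2, Prop. 14.2.3 (a)] -/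
theorem quarticCharMod_mul (a : ℤ) (x y : GaussianInt) :
    quarticCharMod a (x * y) = quarticCharMod a x * quarticCharMod a y := by
  apply Φ₄.injective
  rw [map_mul, map_quarticCharMod, map_quarticCharMod, map_quarticCharMod, map_mul,
    quarticSymbol_mul_right isPrimitiveRoot_ζ₄]

/-- `(x^(k+1)/a)₄ = (x/a)₄^(k+1)` (for `k = 0` the junk value `(1/a)₄ = 0` at even `a` spoils the identity; at an inert prime
see `quarticCharMod_natCast_pow`). [cite: IrelandRosen1982, Ch. 9 §8, Prop. 9.8.3 (b)] -/
theorem quarticCharMod_pow_succ (a : ℤ) (x : GaussianInt) (k : ℕ) :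
    quarticCharMod a (x ^ (k + 1)) = quarticCharMod a x ^ (k + 1) := by
  induction k with
  | zero => rw [zero_add, pow_one, pow_one]
  | succ k ih => rw [pow_succ, quarticCharMod_mul, ih, ← pow_succ]

/-- The values of `(x/a)₄` are `0` or fourth roots of unity. [cite: IrelandRosen1982, Ch. 9 §8, Definition after Prop. 9.8.4; Ch. 14 §2, Definition] -/
theorem quarticCharMod_eq_zero_or_pow_four (a : ℤ) (x : GaussianInt) :
    quarticCharMod a x = 0 ∨ quarticCharMod a x ^ 4 = 1 := by
  have h := quarticSymbol_eq_zero_or_pow_four_eq_one isPrimitiveRoot_ζ₄ (Ideal.span {(a : 𝓞 K₄)}) (Φ₄ x)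
  rw [← map_quarticCharMod, ← map_pow, ← map_one Φ₄, ← map_zero Φ₄] at h
  exact h.imp (fun h ↦ Φ₄.injective h) (fun h ↦ Φ₄.injective h)

/-- **«If `β ≡ γ (α)` then `χ_α(β) = χ_α(γ)`»**: `(x/a)₄` is a function of `x mod a`. [cite: IrelandRosen1982, Ch. 9 §8, Definition after Prop. 9.8.4 (remark)] -/
theorem quarticCharMod_eq_of_dvd_sub {a : ℤ} {x x' : GaussianInt} (h : (a : GaussianInt) ∣ x - x') :
    quarticCharMod a x = quarticCharMod a x' := by
  apply Φ₄.injective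
  rw [map_quarticCharMod, map_quarticCharMod]
  apply quarticSymbol_eq_of_sub_mem
  rw [Ideal.mem_span_singleton, ← map_sub, show (a : 𝓞 K₄) = Φ₄ (a : GaussianInt) from (map_intCast Φ₄ a).symm,
    map_dvd_iff]
  exact h

/-- Periodicity: `((x + a y)/a)₄ = (x/a)₄`. [cite: IrelandRosen1982, Ch. 9 §8, Definition after Prop. 9.8.4 (remark)] -/
theorem quarticCharMod_add_mul (a : ℤ) (x y : GaussianInt) :
    quarticCharMod a (x + a * y) = quarticCharMod a x :=
  quarticCharMod_eq_of_dvd_sub ⟨y, by ring⟩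

/-- **Prop. 9.9.8 on `GaussianInt`, symbol form: `(a/x)₄ = (x/a)₄`** for `a ≡ 1 (4)` and primary `x` coprime to `a`
(the tree's `map_quarticSymbolInt_of_isPrimary`, read back through `Φ₄`). [cite: IrelandRosen1982, Ch. 9 §9, Prop. 9.9.8] -/
theorem quarticSymbolInt_eq_quarticCharMod_of_isPrimary {a : ℤ} (ha : a % 4 = 1) {x : GaussianInt} (hx : IsPrimary x)
    (hcop : IsCoprime x (a : GaussianInt)) : quarticSymbolInt a x = quarticCharMod a x := by
  apply Φ₄.injective
  rw [map_quarticSymbolInt_of_isPrimary ha hx hcop, map_quarticCharMod]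

end Mod

/-! ### §2 The quartic residue character modulo an inert prime `q ≡ 3 (4)` -/

section Inert

variable {q : ℕ} (hq : q.Prime) (hq3 : q % 4 = 3)
include hq hq3

/-- `q ≡ 3 (4)` is prime in `ℤ[i]` (Ch. 9 §7 Lemma 4; Mathlib's inert law). [cite: IrelandRosen1982, Ch. 9 §7, Lemma 4] -/
theorem prime_natCast_of_mod_four_eq_three' : Prime (q : GaussianInt) :=
  haveI := Fact.mk hq
  (GaussianInt.prime_iff_mod_four_eq_three_of_nat_prime q).mpr hq3

/-- `q ∣ N(x)` iff `q ∣ x` in `ℤ[i]`, for an inert prime `q ≡ 3 (4)` (`N(x) = x x̄` and `q` is prime in `ℤ[i]`;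
`q ∣ x̄ ⇒ q = q̄ ∣ x`). [cite: IrelandRosen1982, Ch. 9 §7, Lemma 4] -/
theorem natCast_dvd_norm_iff (x : GaussianInt) : (q : ℤ) ∣ x.norm ↔ (q : GaussianInt) ∣ x := by
  have hqp : Prime (q : GaussianInt) := prime_natCast_of_mod_four_eq_three' hq hq3
  constructor
  · intro h
    have h' : (q : GaussianInt) ∣ (x.norm : GaussianInt) := by
      obtain ⟨k, hk⟩ := h; exact ⟨k, by rw [hk]; push_cast; ring⟩
    rw [cast_norm_eq] at h'
    rcases hqp.dvd_or_dvd h' with h | h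
    · exact h
    · obtain ⟨k, hk⟩ := h
      refine ⟨star k, ?_⟩
      rw [← star_star x, hk, star_mul', show star (q : GaussianInt) = q from ?_]
      ext <;> simp
  · rintro ⟨k, rfl⟩
    rw [Zsqrtd.norm_mul, Zsqrtd.norm_natCast]
    exact Dvd.dvd.mul_right (dvd_mul_right (q : ℤ) q) _

/-- At the inert place `(q)`: `Φ₄ ((x/q)₄) = χ_{(q)}(Φ₄ x)`, the tree's quartic residue symbol of the place `inertPlace`
(on the model `K₄`, whose `IsCyclotomicExtension {4} ℚ K₄` structure is the theorem `isCyclotomicExtension_K₄`, not an instance).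
[cite: IrelandRosen1982, Ch. 9 §8, Prop. 9.8.3 (f) and Prop. 9.8.4] -/
theorem map_quarticCharMod_natCast (x : GaussianInt) :
    haveI := isCyclotomicExtension_K₄
    Φ₄ (quarticCharMod q x) =
      quarticResidueSymbol (inertPlace (K := K₄) hq hq3) (Ideal.Quotient.mk (inertPlace (K := K₄) hq hq3).asIdeal (Φ₄ x)) := by
  haveI := isCyclotomicExtension_K₄
  rw [map_quarticCharMod, Int.cast_natCast, quarticSymbol_span_of_span_eq (inertPlace_asIdeal (K := K₄) hq hq3)]

/-- `Φ₄ x ≡ 0 (mod (q))` iff `q ∣ x`. [cite: IrelandRosen1982, Ch. 9 §7, Lemma 4] -/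
theorem mk_inertPlace_eq_zero_iff (x : GaussianInt) :
    haveI := isCyclotomicExtension_K₄
    Ideal.Quotient.mk (inertPlace (K := K₄) hq hq3).asIdeal (Φ₄ x) = 0 ↔ (q : GaussianInt) ∣ x := by
  haveI := isCyclotomicExtension_K₄
  rw [Ideal.Quotient.eq_zero_iff_mem, inertPlace_asIdeal, Ideal.mem_span_singleton,
    show (q : 𝓞 K₄) = Φ₄ (q : GaussianInt) from (map_natCast Φ₄ q).symm, map_dvd_iff]

/-- **`(x/q)₄ = 0` iff `q ∣ x`** («if `π ∣ α` then `χ_π(α) = 0`», and otherwise a fourth root of unity).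
[cite: IrelandRosen1982, Ch. 9 §8, Definition after Prop. 9.8.2; Prop. 9.8.3 (a)] -/
theorem quarticCharMod_natCast_eq_zero_iff (x : GaussianInt) : quarticCharMod q x = 0 ↔ (q : GaussianInt) ∣ x := by
  haveI := isCyclotomicExtension_K₄
  rw [← map_eq_zero_iff _ Φ₄.injective, map_quarticCharMod_natCast hq hq3, ← mk_inertPlace_eq_zero_iff hq hq3 x]
  constructor
  · intro h
    by_contra hne
    exact ((quarticResidueSymbol_ne_zero_iff isPrimitiveRoot_ζ₄).mpr ⟨two_not_mem_inertPlace hq hq3, hne⟩) h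
  · intro h
    rw [h, quarticResidueSymbol_zero isPrimitiveRoot_ζ₄]

/-- **Euler's criterion at the inert prime (Prop. 9.8.2 and the Definition of `χ`, with `N(q) = q²`):** for `q ∤ x`,
`q ∣ x^{(q²-1)/4} − (x/q)₄` in `ℤ[i]` and `(x/q)₄⁴ = 1`. [cite: IrelandRosen1982, Ch. 9 §8, Prop. 9.8.2 and Definition; Prop. 9.8.4 (`N(q) = q²`)] -/
theorem quarticCharMod_natCast_spec {x : GaussianInt} (hx : ¬ (q : GaussianInt) ∣ x) :
    (q : GaussianInt) ∣ x ^ ((q ^ 2 - 1) / 4) - quarticCharMod q x ∧ quarticCharMod q x ^ 4 = 1 := by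
  haveI := isCyclotomicExtension_K₄
  have hne : Ideal.Quotient.mk (inertPlace (K := K₄) hq hq3).asIdeal (Φ₄ x) ≠ 0 :=
    fun h ↦ hx ((mk_inertPlace_eq_zero_iff hq hq3 x).mp h)
  obtain ⟨h4, hmk⟩ := quarticResidueSymbol_spec isPrimitiveRoot_ζ₄ (two_not_mem_inertPlace hq hq3) hne
  rw [residueCard_inertPlace, ← map_quarticCharMod_natCast hq hq3, ← map_pow, eq_comm, Ideal.Quotient.eq,
    inertPlace_asIdeal, Ideal.mem_span_singleton, ← map_pow, ← map_sub,
    show (q : 𝓞 K₄) = Φ₄ (q : GaussianInt) from (map_natCast Φ₄ q).symm, map_dvd_iff] at hmk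
  refine ⟨hmk, Φ₄.injective ?_⟩
  rw [map_pow, map_quarticCharMod_natCast hq hq3, h4, map_one]

/-- **The Definition as a characterisation:** a fourth root of unity `u ∈ ℤ[i]` with `q ∣ x^{(q²-1)/4} − u` IS `(x/q)₄`.
[cite: IrelandRosen1982, Ch. 9 §8, Prop. 9.8.2 and Definition] -/
theorem quarticCharMod_natCast_eq_of_pow_four_eq_one {x u : GaussianInt} (hu : u ^ 4 = 1)
    (h : (q : GaussianInt) ∣ x ^ ((q ^ 2 - 1) / 4) - u) : quarticCharMod q x = u := by
  haveI := isCyclotomicExtension_K₄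
  apply Φ₄.injective
  rw [map_quarticCharMod_natCast hq hq3]
  refine quarticResidueSymbol_eq_of_pow_four_eq_one isPrimitiveRoot_ζ₄ (two_not_mem_inertPlace hq hq3)
    (by rw [← map_pow, hu, map_one]) ?_
  rw [residueCard_inertPlace, ← map_pow, eq_comm, Ideal.Quotient.eq, inertPlace_asIdeal, Ideal.mem_span_singleton,
    ← map_pow, ← map_sub, show (q : 𝓞 K₄) = Φ₄ (q : GaussianInt) from (map_natCast Φ₄ q).symm, map_dvd_iff]
  exact h

/-- **Prop. 9.8.4: `(n/q)₄ = 1` for a rational integer `n` with `q ∤ n`** (`n^{(q²-1)/4} = (n^{q-1})^{(q+1)/4} ≡ 1`).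
[cite: IrelandRosen1982, Ch. 9 §8, Prop. 9.8.4] -/
theorem quarticCharMod_natCast_intCast {n : ℤ} (hn : ¬ (q : ℤ) ∣ n) : quarticCharMod q n = 1 := by
  haveI := isCyclotomicExtension_K₄
  apply Φ₄.injective
  rw [map_quarticCharMod_natCast hq hq3, map_intCast, map_one]
  exact quarticResidueSymbol_intCast_eq_one_of_residueCard_eq_sq isPrimitiveRoot_ζ₄ hq hq3
    (by rw [inertPlace_asIdeal]; exact Ideal.mem_span_singleton_self _) (residueCard_inertPlace hq hq3) hn

/-- `(1/q)₄ = 1`. [cite: IrelandRosen1982, Ch. 9 §8, Prop. 9.8.3 (b)] -/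
theorem quarticCharMod_natCast_one : quarticCharMod q 1 = 1 := by
  have h := quarticCharMod_natCast_intCast hq hq3 (n := 1)
    (fun h ↦ hq.one_lt.ne' (by exact_mod_cast Int.eq_one_of_dvd_one (Int.natCast_nonneg q) h))
  simpa using h

/-- `(x^k/q)₄ = (x/q)₄^k` (a character of `(ℤ[i]/q)ˣ = 𝔽_{q²}ˣ`, extended by `0`). [cite: IrelandRosen1982, Ch. 9 §8, Prop. 9.8.3 (b)] -/
theorem quarticCharMod_natCast_pow (x : GaussianInt) (k : ℕ) : quarticCharMod q (x ^ k) = quarticCharMod q x ^ k := by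
  cases k with
  | zero => rw [pow_zero, pow_zero, quarticCharMod_natCast_one hq hq3]
  | succ k => exact quarticCharMod_pow_succ q x k

/-- `(u/q)₄ = u^{(q²-1)/4}` for a unit `u` of `ℤ[i]` (a unit is its own fourth-root-of-unity witness in Euler's criterion;
so `(±1/q)₄ = 1` and `(±i/q)₄ = (-1)^{(q+1)/4}`, Prop. 9.8.6). [cite: IrelandRosen1982, Ch. 9 §8, Prop. 9.8.3 (d) and Prop. 9.8.6 (proof)] -/
theorem quarticCharMod_natCast_of_isUnit {u : GaussianInt} (hu : IsUnit u) :
    quarticCharMod q u = u ^ ((q ^ 2 - 1) / 4) := by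
  have hu4 : u ^ 4 = 1 := by rcases eq_of_isUnit hu with rfl | rfl | rfl | rfl <;> decide
  refine quarticCharMod_natCast_eq_of_pow_four_eq_one hq hq3 ?_ (by rw [sub_self]; exact dvd_zero _)
  rw [← pow_mul, mul_comm, pow_mul, hu4, one_pow]

/-- **Conjugation: `(x̄/q)₄ = \overline{(x/q)₄}`** (`q̄ = q`, so `x̄^{(q²-1)/4} ≡ \overline{(x/q)₄} (mod q)`; Prop. 9.8.3 (c) at the
self-conjugate prime `q`). [cite: IrelandRosen1982, Ch. 9 §8, Prop. 9.8.3 (c)] -/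
theorem quarticCharMod_natCast_star (x : GaussianInt) : quarticCharMod q (star x) = star (quarticCharMod q x) := by
  by_cases hqx : (q : GaussianInt) ∣ x
  · have h1 : quarticCharMod q x = 0 := (quarticCharMod_natCast_eq_zero_iff hq hq3 x).mpr hqx
    have h2 : (q : GaussianInt) ∣ star x := by
      obtain ⟨k, hk⟩ := hqx
      exact ⟨star k, by rw [hk, star_mul', star_natCast]⟩
    rw [h1, star_zero, (quarticCharMod_natCast_eq_zero_iff hq hq3 _).mpr h2]
  · obtain ⟨hdvd, h4⟩ := quarticCharMod_natCast_spec hq hq3 hqx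
    refine quarticCharMod_natCast_eq_of_pow_four_eq_one hq hq3 (by rw [← star_pow, h4, star_one]) ?_
    obtain ⟨k, hk⟩ := hdvd
    exact ⟨star k, by rw [← star_pow, ← star_sub, hk, star_mul', star_natCast]⟩

/-- `(-q/q)₄ = 0` (the prime `q` divides `-q`). [cite: IrelandRosen1982, Ch. 9 §8, Prop. 9.8.3 (a)] -/
theorem quarticSymbolInt_neg_natCast_natCast : quarticSymbolInt (-q) q = 0 := by
  haveI := isCyclotomicExtension_K₄
  apply Φ₄.injective
  rw [map_quarticSymbolInt, map_zero, map_natCast, quarticSymbol_span_of_span_eq (inertPlace_asIdeal (K := K₄) hq hq3),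
    show (Ideal.Quotient.mk _ ((-(q : ℤ) : ℤ) : 𝓞 K₄)) = 0 from ?_]
  · exact quarticResidueSymbol_zero_of_two_not_mem isPrimitiveRoot_ζ₄ (two_not_mem_inertPlace hq hq3)
  · rw [Ideal.Quotient.eq_zero_iff_mem, inertPlace_asIdeal, Ideal.mem_span_singleton]
    exact ⟨-1, by push_cast; ring⟩

/-- **`(-q/x)₄ = (x/q)₄` for primary `x`** — the reciprocity law Prop. 9.9.8 with `a = -q ≡ 1 (4)` (for `q ∣ x` both sides
vanish).  The case `q = 3` is `quarticSymbolInt_neg_three_of_isPrimary`. [cite: IrelandRosen1982, Ch. 9 §9, Prop. 9.9.8; Ch. 9 §8, Prop. 9.8.2] -/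
theorem quarticSymbolInt_neg_natCast_of_isPrimary {x : GaussianInt} (hx : IsPrimary x) :
    quarticSymbolInt (-q) x = quarticCharMod q x := by
  by_cases hqx : (q : GaussianInt) ∣ x
  · obtain ⟨y, rfl⟩ := hqx
    have hy : y ≠ 0 := by rintro rfl; exact hx.ne_zero (mul_zero _)
    have hq0 : (q : GaussianInt) ≠ 0 := by exact_mod_cast hq.ne_zero
    rw [quarticSymbolInt_mul (-q) hq0 hy, quarticSymbolInt_neg_natCast_natCast hq hq3, zero_mul, eq_comm,
      quarticCharMod_natCast_eq_zero_iff hq hq3]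
    exact dvd_mul_right _ _
  · have hcop : IsCoprime x ((-(q : ℤ) : ℤ) : GaussianInt) := by
      rw [Int.cast_neg, IsCoprime.neg_right_iff, Int.cast_natCast]
      exact ((Irreducible.coprime_iff_not_dvd (prime_natCast_of_mod_four_eq_three' hq hq3).irreducible).mpr hqx).symm
    have h4 : (-(q : ℤ)) % 4 = 1 := by omega
    rw [quarticSymbolInt_eq_quarticCharMod_of_isPrimary h4 hx hcop, quarticCharMod_neg]

/-- **The `q`-part of the twist.**  For `D = (-q)^k · D₁` and a primary `x`: `(D/x)₄ = (x/q)₄^k · (D₁/x)₄`.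
The case `q = 3` is `quarticSymbolInt_neg_three_pow_mul_of_isPrimary`. [cite: IrelandRosen1982, Ch. 9 §8, Prop. 9.8.3 (b); Ch. 9 §9, Prop. 9.9.8] -/
theorem quarticSymbolInt_neg_natCast_pow_mul_of_isPrimary (k : ℕ) (D₁ : ℤ) {x : GaussianInt} (hx : IsPrimary x) :
    quarticSymbolInt ((-q) ^ k * D₁) x = quarticCharMod q x ^ k * quarticSymbolInt D₁ x := by
  rw [quarticSymbolInt_mul_left, quarticSymbolInt_pow_left _ _ hx, quarticSymbolInt_neg_natCast_of_isPrimary hq hq3 hx]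

end Inert

/-! ### §3 The case `q = 3`: the table `quarticCharThree` is `(·/3)₄` -/

/-- `quarticCharMod 3 = quarticCharThree`: the tabulated character modulo `3` (`(x/3)₄ ≡ x² (mod 3)`) is the quartic residue
character of the place `(3)`. [cite: IrelandRosen1982, Ch. 9 §8, Prop. 9.8.2 and Definition (at the prime `3`, `N(3) = 9`)] -/
theorem quarticCharMod_three (x : GaussianInt) : quarticCharMod 3 x = quarticCharThree x := by
  by_cases h3 : (3 : GaussianInt) ∣ x
  · rw [(quarticCharThree_eq_zero_iff x).mpr h3]
    exact (quarticCharMod_natCast_eq_zero_iff Nat.prime_three (by norm_num) x).mpr (by exact_mod_cast h3)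
  · obtain ⟨hdvd, h4⟩ := three_dvd_sq_sub_quarticCharThree h3
    exact quarticCharMod_natCast_eq_of_pow_four_eq_one Nat.prime_three (by norm_num) h4
      (by rw [show ((3 ^ 2 - 1) / 4 : ℕ) = 2 by norm_num]; exact_mod_cast hdvd)

end Literature.NumberTheory.QuadraticFields.GaussianQuarticSymbol

end
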